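import Literature.Geometry.Kaehler.ComplexTorusIntegralHardLefschetzMinimalClassDegreeThree
import Literature.Geometry.Kaehler.ComplexTorusIntegralCoLefschetzMinimalClassCokernels
import Mathlib.GroupTheory.Perm.Cycle.Type
import HarnessLib

/-!
# Hard Lefschetz modulo a prime with the minimal classes: `γ_{g−k} ∧ H^k(X, ℤ) + p·H^{2g−k}(X, ℤ) = H^{2g−k}(X, ℤ)`
# iff `p ∤ d_g/d₁` (`k = 1`), iff `p ∤ (g−1)·d_g/d₁` (`k = 2`, `g ≥ 3`), iff `p ∤ (g−2)·d_g/d₁` (`k = 3`, `g ≥ 4`)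

Layer `Literature/Geometry/Kaehler`, namespace `Literature.Geometry.Kaehler.ComplexTorus`; lane `lit-hodgefound` (Track 2
foundations library), seat p09, generation 40, row g40-#8. THEOREMS ONLY (0 definitions); no named fact, net debt 0. Sequel of
g40-#5 `ComplexTorusIntegralCoLefschetzMinimalClassCokernels` (`[H^{2g−1}(X, ℤ) : γ_{g−1} ∧ H¹(X, ℤ)] = (∏_a d_g/d_a)²`), g40-#6
`ComplexTorusIntegralHardLefschetzMinimalClassDegreeTwo` (`[H^{2g−2}(X, ℤ) : γ_{g−2} ∧ H²(X, ℤ)] = (g−1)·∏_i ((d_{g−1}/d_i)(d_g/d_i))^{2g−1}`)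
and g40-#7 `ComplexTorusIntegralHardLefschetzMinimalClassDegreeThree` (the degree-three index).

Sources (the statements being made precise over `ℤ` and modulo `p`):

* Lange 2023 §5.4.1 Thm. 5.4.1 (PDF p. 275: hard Lefschetz `L^{g−k} : H^k ⥲ H^{2g−k}` over `ℂ`) and (5.22); §2.5.3 Thm. 2.5.16 / Cor. 2.5.17
  (PDF p. 135); §4.2 (PDF p. 204); §1.5.1 (PDF p. 51: types `d₁ ∣ ⋯ ∣ d_g`); §1.1.3 Exercise 1.1.6 (8);
* Voisin 2002 §6.2.3 Thm. 6.25 (PDF p. 125) and §7.1.2 (PDF p. 134 L31: `L` acts on `H^•(X, ℤ)`; hard Lefschetz is a statement with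
  rational coefficients);
* Benoist–Debarre 2023 §1 (p. 3): the minimal cohomology classes `θ^c/c!`.

Setting (`θ = ofRealForm η`, symplectic enumeration `e₀` of type `d₁ ∣ ⋯ ∣ d_g` for the Riemann form `η` on `X = E/Φ(ℤ^ι)`; the minimal
classes `γ_q = θ^{∧q}/(q!·d₁⋯d_q)`, the optimal integral generators of the Lefschetz lines). Since `H^•(X, ℤ) = ⋀^• ℤ^{2g}` is torsion
free, `H^•(X, ℤ/p) = H^•(X, ℤ)/p` and the reduction modulo `p` of `γ_{g−k} ∧ (−) : H^k(X, ℤ) → H^{2g−k}(X, ℤ)` (a map between free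
`ℤ`-modules of the same rank) is an ISOMORPHISM over `ℤ/p` iff it is onto modulo `p`, i.e. iff the sublattice
`γ_{g−k} ∧ H^k(X, ℤ) + p·H^{2g−k}(X, ℤ)` is all of `H^{2g−k}(X, ℤ)`, iff `p` does not divide the index `[H^{2g−k}(X, ℤ) : γ_{g−k} ∧ H^k(X, ℤ)]`
(§0: a lattice lemma — Bézout one way, Cauchy's theorem the other). Reading off the prime divisors of the indices of g40-#5/#6/#7
(every ratio `d_m/d_i`, `i ≤ m`, divides `d_g/d₁`):

  **`γ_{g−1} ∧ H¹(X, ℤ) + p·H^{2g−1}(X, ℤ) = H^{2g−1}(X, ℤ)` iff `p ∤ d_g/d₁`** (`g ≥ 2`);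
  **`γ_{g−2} ∧ H²(X, ℤ) + p·H^{2g−2}(X, ℤ) = H^{2g−2}(X, ℤ)` iff `p ∤ g − 1` and `p ∤ d_g/d₁`** (`g ≥ 3`);
  **`γ_{g−3} ∧ H³(X, ℤ) + p·H^{2g−3}(X, ℤ) = H^{2g−3}(X, ℤ)` iff `p ∤ g − 2` and `p ∤ d_g/d₁`** (`g ≥ 4`)

— so for a principal polarisation (or any type with `d_g = d₁`) hard Lefschetz with `ℤ/p`-coefficients and the divided powers
`θ^{g−1}/(g−1)!`, `θ^{g−2}/(g−2)!`, `θ^{g−3}/(g−3)!` holds in degrees `1`, `2`, `3` exactly for all `p`, for `p ∤ g − 1`, for `p ∤ g − 2`.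

## Contents (theorems only)

* §0 (private) the lattice lemma `M + p·H = H ⟺ p ∤ [H : M]` (for a subgroup `M ≤ H` of finite index in an abelian group and
  a prime `p`); the arithmetic of a type: `d_m/d_i ∣ d_g/d₁`, the prime divisors of the three indices.
* §1 degree one (`g = j + 2`): **`IsSymplecticEnum.map_wedge_integralForms_one_sup_map_nsmul_eq_iff_of_eq_content_smul`**.
* §2 degree two (`g = j + 2 ≥ 3`): **`IsSymplecticEnum.map_wedge_integralForms_two_sup_map_nsmul_eq_iff_of_eq_content_smul`**.
* §3 degree three (`g = j + 3 ≥ 4`): **`IsSymplecticEnum.map_wedge_integralForms_three_hardLefschetz_sup_map_nsmul_eq_iff_of_eq_content_smul`**.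
* §4 basis-free forms: `IsPolarizationType.…` versions.

## References

* [cite: Lange2023AbelianVarietiesComplex, §5.4.1 Thm. 5.4.1 and (5.22) (PDF p. 275); §2.5.3 Thm. 2.5.16 and Cor. 2.5.17 (PDF p. 135);
  §4.2 (PDF p. 204); §1.5.1 (PDF p. 51); §1.1.3 Exercise 1.1.6 (8); §2.1.1 (principal)]
* [cite: VoisinHodgeI2002, §6.2.3 Thm. 6.25 (PDF p. 125); §7.1.2 (PDF p. 134 L31)]
* [cite: BenoistDebarre2023SmoothSubvarietiesJacobians, §1 (p. 3)]
-/

noncomputable section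

open Module Function
open Literature.LinearAlgebra.Alternating

namespace Literature.Geometry.Kaehler.ComplexTorus

section HardLefschetzModPrime

/-! ## §0 A lattice lemma and the arithmetic of a type -/

/-- **`M + p·H = H ⟺ p ∤ [H : M]`** for a subgroup `M ≤ H` of finite index in an abelian group and a prime `p` — the reduction modulo `p`
of the inclusion `M ↪ H` is onto iff `p` is prime to the index. (`⟸`: Bézout `u p + v [H:M] = 1` and `[H:M]·H ⊆ M`; `⟹`: if `p ∣ [H:M]`,
Cauchy's theorem gives a class of order `p` in `H/M`, but `M + pH = H` makes multiplication by `p` onto, hence one-to-one, on the finite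
group `H/M`.) [folklore] -/
private theorem sup_map_nsmul_eq_iff_not_dvd_relIndex₄₂ {G : Type*} [AddCommGroup G] {M H : AddSubgroup G} (hMH : M ≤ H)
    (hfin : M.relIndex H ≠ 0) {p : ℕ} (hp : p.Prime) :
    M ⊔ H.map (nsmulAddMonoidHom p) = H ↔ ¬ p ∣ M.relIndex H := by
  have hpH : H.map (nsmulAddMonoidHom p) ≤ H := by
    rintro _ ⟨x, hx, rfl⟩
    exact H.nsmul_mem hx p
  constructor
  · intro heq hdvd
    haveI : Fact p.Prime := ⟨hp⟩
    haveI : (M.addSubgroupOf H).FiniteIndex := ⟨hfin⟩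
    obtain ⟨g, hg⟩ := exists_prime_addOrderOf_dvd_card' (G := ↥H ⧸ M.addSubgroupOf H) p hdvd
    -- multiplication by `p` is onto `H/M`
    have hsurj : Function.Surjective fun q : ↥H ⧸ M.addSubgroupOf H ↦ p • q := by
      intro q
      induction q using QuotientAddGroup.induction_on with
      | H y =>
        have hy : (y : G) ∈ M ⊔ H.map (nsmulAddMonoidHom p) := by
          rw [heq]
          exact y.2
        obtain ⟨s, hs, _, ⟨z, hz, rfl⟩, hsz⟩ := AddSubgroup.mem_sup.1 hy
        refine ⟨QuotientAddGroup.mk ⟨z, hz⟩, ?_⟩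
        show p • (QuotientAddGroup.mk ⟨z, hz⟩ : ↥H ⧸ M.addSubgroupOf H) = QuotientAddGroup.mk y
        rw [← QuotientAddGroup.mk_nsmul, QuotientAddGroup.eq, AddSubgroup.mem_addSubgroupOf, AddSubgroup.coe_add, AddSubgroup.coe_neg,
          AddSubgroup.coe_nsmul, ← hsz, nsmulAddMonoidHom_apply, show -(p • z) + (s + p • z) = s by abel]
        exact hs
    have hinj := Finite.injective_iff_surjective.2 hsurj
    have hg0 : g ≠ 0 := fun h0 ↦ hp.one_lt.ne' (by rw [← hg, h0, addOrderOf_zero])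
    refine hg0 (hinj ?_)
    show p • g = p • (0 : ↥H ⧸ M.addSubgroupOf H)
    rw [smul_zero, ← hg, addOrderOf_nsmul_eq_zero]
  · intro hnd
    refine le_antisymm (sup_le hMH hpH) fun x hx ↦ ?_
    obtain ⟨u, v, huv⟩ : IsCoprime (p : ℤ) (M.relIndex H : ℤ) :=
      Nat.isCoprime_iff_coprime.2 ((Nat.Prime.coprime_iff_not_dvd hp).2 hnd)
    have hN : M.relIndex H • x ∈ M := M.nsmul_relIndex_mem hx
    have h1 : x = (v * (M.relIndex H : ℤ)) • x + (u * (p : ℤ)) • x := by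
      rw [← add_smul, add_comm, huv, one_smul]
    rw [h1]
    refine AddSubgroup.add_mem_sup ?_ ?_
    · rw [mul_smul, natCast_zsmul]
      exact M.zsmul_mem hN v
    · rw [mul_comm, mul_smul, natCast_zsmul]
      exact ⟨u • x, H.zsmul_mem hx u, rfl⟩

/-- An increasing map `Fin q → Fin g` dominates the identity: `i ≤ f i`. [folklore] -/
private theorem val_le_apply_of_strictMono₄₂ {q g : ℕ} {f : Fin q → Fin g} (hf : StrictMono f) :
    ∀ (n : ℕ) (hn : n < q), n ≤ (f ⟨n, hn⟩ : ℕ)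
  | 0, _ => Nat.zero_le _
  | n + 1, hn => by
    have h1 := val_le_apply_of_strictMono₄₂ hf n (Nat.lt_of_succ_lt hn)
    have h2 : f ⟨n, Nat.lt_of_succ_lt hn⟩ < f ⟨n + 1, hn⟩ := hf (Fin.mk_lt_mk.2 n.lt_succ_self)
    exact Nat.succ_le_of_lt (lt_of_le_of_lt h1 (Fin.lt_def.1 h2))

/-- **Every ratio `d_m/d_i` (`i ≤ m`) of a type divides `d_g/d₁`.** [cite: Lange2023AbelianVarietiesComplex, §1.5.1 (PDF p. 51)] -/
private theorem div_dvd_div_last₄₂ {n : ℕ} {d : Fin (n + 1) → ℕ} (hd : ∀ i i' : Fin (n + 1), i ≤ i' → d i ∣ d i')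
    (hpos : ∀ i, 0 < d i) {i m : Fin (n + 1)} (him : i ≤ m) : d m / d i ∣ d (Fin.last n) / d 0 := by
  obtain ⟨q1, hq1⟩ := hd 0 i (Fin.zero_le _)
  obtain ⟨q2, hq2⟩ := hd i m him
  obtain ⟨q3, hq3⟩ := hd m (Fin.last n) (Fin.le_last _)
  have hmi : d m / d i = q2 := by rw [hq2, Nat.mul_div_cancel_left _ (hpos i)]
  have hl0 : d (Fin.last n) / d 0 = q1 * q2 * q3 := by
    rw [hq3, hq2, hq1, mul_assoc, mul_assoc, Nat.mul_div_cancel_left _ (hpos 0), mul_assoc]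
  rw [hmi, hl0]
  exact ⟨q1 * q3, by ring⟩

/-- **`(∏_{ν ∈ T} d_ν)/(d₁⋯d_q)` divides `(d_g/d₁)^q`** for a `q`-subset `T`: enumerate `T` increasingly, `t_i ≥ i`, so the quotient is
`∏_i d_{t_i}/d_i`. [cite: Lange2023AbelianVarietiesComplex, §1.5.1 (PDF p. 51)] -/
private theorem prod_div_prod_castLE_dvd_pow₄₂ {n : ℕ} {d : Fin (n + 1) → ℕ} (hd : ∀ i i' : Fin (n + 1), i ≤ i' → d i ∣ d i')
    (hpos : ∀ i, 0 < d i) {q : ℕ} (hq : q ≤ n + 1) {T : Finset (Fin (n + 1))} (hT : T.card = q) :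
    (∏ ν ∈ T, d ν) / ∏ i : Fin q, d (Fin.castLE hq i) ∣ (d (Fin.last n) / d 0) ^ q := by
  have hsm := (T.orderEmbOfFin hT).strictMono
  have hle : ∀ i : Fin q, Fin.castLE hq i ≤ T.orderEmbOfFin hT i := fun i ↦ by
    rw [Fin.le_def, Fin.val_castLE]
    exact val_le_apply_of_strictMono₄₂ hsm i i.2
  have himg : ∏ ν ∈ T, d ν = ∏ i : Fin q, d (T.orderEmbOfFin hT i) := by
    conv_lhs => rw [← Finset.image_orderEmbOfFin_univ T hT]
    rw [Finset.prod_image fun a _ b _ hab ↦ (T.orderEmbOfFin hT).injective hab]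
  have hprod : ∏ ν ∈ T, d ν = (∏ i : Fin q, d (Fin.castLE hq i)) * ∏ i : Fin q, (d (T.orderEmbOfFin hT i) / d (Fin.castLE hq i)) := by
    rw [himg, ← Finset.prod_mul_distrib]
    exact Finset.prod_congr rfl fun i _ ↦ (Nat.mul_div_cancel' (hd _ _ (hle i))).symm
  rw [hprod, Nat.mul_div_cancel_left _ (Finset.prod_pos fun i _ ↦ hpos _), ← Fin.prod_const]
  exact Finset.prod_dvd_prod_of_dvd _ _ fun i _ ↦ div_dvd_div_last₄₂ hd hpos (hle i)

/-- Prime divisors of the degree-one index `(∏_a d_g/d_a)²`: exactly those of `d_g/d₁`. [cite: Lange2023AbelianVarietiesComplex, §1.5.1 (PDF p. 51)] -/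
private theorem dvd_index_one_iff₄₂ {j : ℕ} {d : Fin (j + 2) → ℕ} (hd : ∀ i i' : Fin (j + 2), i ≤ i' → d i ∣ d i') (hpos : ∀ i, 0 < d i)
    {p : ℕ} (hp : p.Prime) :
    p ∣ (∏ a : Fin (j + 2), (d (Fin.last (j + 1)) / d a)) ^ 2 ↔ p ∣ d (Fin.last (j + 1)) / d 0 := by
  have hp' := Nat.prime_iff.1 hp
  constructor
  · intro h
    obtain ⟨a, -, ha⟩ := (Prime.dvd_finsetProd_iff hp' _).1 (hp'.dvd_of_dvd_pow h)
    exact ha.trans (div_dvd_div_last₄₂ hd hpos (Fin.le_last a))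
  · intro h
    exact dvd_pow (h.trans (Finset.dvd_prod_of_mem (fun a : Fin (j + 2) ↦ d (Fin.last (j + 1)) / d a)
      (Finset.mem_univ (0 : Fin (j + 2))))) two_ne_zero

/-- Prime divisors of the degree-two index `(g−1)·∏_{i ≤ g−2} ((d_{g−1}/d_i)(d_g/d_i))^{2g−1}` (`g = j + 2 ≥ 3`): those of `g − 1` and of `d_g/d₁`.
[cite: Lange2023AbelianVarietiesComplex, §1.5.1 (PDF p. 51)] -/
private theorem dvd_index_two_iff₄₂ {j : ℕ} {d : Fin (j + 2) → ℕ} (hd : ∀ i i' : Fin (j + 2), i ≤ i' → d i ∣ d i') (hpos : ∀ i, 0 < d i)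
    (hj : 1 ≤ j) (hle : j ≤ j + 2) {p : ℕ} (hp : p.Prime) :
    p ∣ (j + 1) * (∏ i : Fin j, (d (Fin.last j).castSucc / d (Fin.castLE hle i)) * (d (Fin.last (j + 1)) / d (Fin.castLE hle i))) ^ (2 * j + 3) ↔
      p ∣ j + 1 ∨ p ∣ d (Fin.last (j + 1)) / d 0 := by
  have hp' := Nat.prime_iff.1 hp
  have hia : ∀ i : Fin j, Fin.castLE hle i ≤ (Fin.last j).castSucc := fun i ↦ Fin.le_def.2 (show (i : ℕ) ≤ j from i.2.le)
  have hi₀ : Fin.castLE hle ⟨0, hj⟩ = 0 := Fin.ext (by simp)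
  constructor
  · intro h
    rcases hp.dvd_mul.1 h with h1 | h1
    · exact Or.inl h1
    obtain ⟨i, -, hi⟩ := (Prime.dvd_finsetProd_iff hp' _).1 (hp'.dvd_of_dvd_pow h1)
    refine Or.inr ?_
    rcases hp.dvd_mul.1 hi with h2 | h2
    · exact h2.trans (div_dvd_div_last₄₂ hd hpos (hia i))
    · exact h2.trans (div_dvd_div_last₄₂ hd hpos (Fin.le_last _))
  · rintro (h | h)
    · exact h.mul_right _
    refine Dvd.dvd.mul_left (dvd_pow ?_ (by omega)) _
    have h0 : p ∣ (d (Fin.last j).castSucc / d (Fin.castLE hle ⟨0, hj⟩)) * (d (Fin.last (j + 1)) / d (Fin.castLE hle ⟨0, hj⟩)) := by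
      rw [hi₀]
      exact h.mul_left _
    exact h0.trans (Finset.dvd_prod_of_mem
      (fun i : Fin j ↦ (d (Fin.last j).castSucc / d (Fin.castLE hle i)) * (d (Fin.last (j + 1)) / d (Fin.castLE hle i)))
      (Finset.mem_univ (⟨0, hj⟩ : Fin j)))

/-- Prime divisors of the degree-three index of g40-#7 (`g = j + 3 ≥ 4`): those of `g − 2` and of `d_g/d₁`.
[cite: Lange2023AbelianVarietiesComplex, §1.5.1 (PDF p. 51)] -/
private theorem dvd_index_three_iff₄₂ {j : ℕ} {d : Fin (j + 3) → ℕ} (hd : ∀ i i' : Fin (j + 3), i ≤ i' → d i ∣ d i') (hpos : ∀ i, 0 < d i)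
    (hj : 1 ≤ j) (hle : j ≤ j + 3) {p : ℕ} (hp : p.Prime) :
    p ∣ (∏ u : {u : Fin 3 → Fin (j + 3) ⊕ Fin (j + 3) //
            Sum.elim id id (u 0) < Sum.elim id id (u 1) ∧ Sum.elim id id (u 1) < Sum.elim id id (u 2)},
          (∏ ν ∈ (Finset.univ.image fun m ↦ Sum.elim id id (u.1 m))ᶜ, d ν) / ∏ i : Fin j, d (Fin.castLE hle i)) *
        ∏ x : Fin (j + 3) ⊕ Fin (j + 3), ((j + 1) *
          ((∏ i : Fin j, (d (Fin.last j).castSucc.castSucc / d (Fin.castLE hle i)) *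
              (d (Fin.last (j + 1)).castSucc / d (Fin.castLE hle i))) *
            (d (Fin.last (j + 2)) / d (Sum.elim id id x)) ^ j)) ↔
      p ∣ j + 1 ∨ p ∣ d (Fin.last (j + 2)) / d 0 := by
  have hp' := Nat.prime_iff.1 hp
  have hia : ∀ i : Fin j, Fin.castLE hle i ≤ (Fin.last j).castSucc.castSucc := fun i ↦ Fin.le_def.2 (show (i : ℕ) ≤ j from i.2.le)
  have hib : ∀ i : Fin j, Fin.castLE hle i ≤ (Fin.last (j + 1)).castSucc := fun i ↦ Fin.le_def.2 (show (i : ℕ) ≤ j + 1 by omega)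
  have hcard : ∀ u : {u : Fin 3 → Fin (j + 3) ⊕ Fin (j + 3) //
      Sum.elim id id (u 0) < Sum.elim id id (u 1) ∧ Sum.elim id id (u 1) < Sum.elim id id (u 2)},
      ((Finset.univ.image fun m ↦ Sum.elim id id (u.1 m))ᶜ).card = j := fun u ↦ by
    have hsm : StrictMono fun m ↦ Sum.elim id id (u.1 m) := by
      refine Fin.strictMono_iff_lt_succ.2 fun i ↦ ?_
      fin_cases i
      · exact u.2.1
      · exact u.2.2
    rw [Finset.card_compl, Finset.card_image_of_injective _ hsm.injective, Finset.card_univ, Fintype.card_fin, Fintype.card_fin]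
    omega
  constructor
  · intro h
    rcases hp.dvd_mul.1 h with h1 | h1
    · obtain ⟨u, -, hu⟩ := (Prime.dvd_finsetProd_iff hp' _).1 h1
      exact Or.inr (hp'.dvd_of_dvd_pow (hu.trans (prod_div_prod_castLE_dvd_pow₄₂ hd hpos hle (hcard u))))
    obtain ⟨x, -, hx⟩ := (Prime.dvd_finsetProd_iff hp' _).1 h1
    rcases hp.dvd_mul.1 hx with h2 | h2
    · exact Or.inl h2
    refine Or.inr ?_
    rcases hp.dvd_mul.1 h2 with h3 | h3
    · obtain ⟨i, -, hi⟩ := (Prime.dvd_finsetProd_iff hp' _).1 h3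
      rcases hp.dvd_mul.1 hi with h4 | h4
      · exact h4.trans (div_dvd_div_last₄₂ hd hpos (hia i))
      · exact h4.trans (div_dvd_div_last₄₂ hd hpos (hib i))
    · exact (hp'.dvd_of_dvd_pow h3).trans (div_dvd_div_last₄₂ hd hpos (Fin.le_last _))
  · intro h
    refine Dvd.dvd.mul_left ?_ _
    have hx : p ∣ (j + 1) *
        ((∏ i : Fin j, (d (Fin.last j).castSucc.castSucc / d (Fin.castLE hle i)) *
            (d (Fin.last (j + 1)).castSucc / d (Fin.castLE hle i))) *
          (d (Fin.last (j + 2)) / d (Sum.elim id id (Sum.inl 0 : Fin (j + 3) ⊕ Fin (j + 3)))) ^ j) := by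
      rcases h with h | h
      · exact h.mul_right _
      · exact Dvd.dvd.mul_left (Dvd.dvd.mul_left (dvd_pow h (by omega)) _) _
    exact hx.trans (Finset.dvd_prod_of_mem (fun x : Fin (j + 3) ⊕ Fin (j + 3) ↦ (j + 1) *
        ((∏ i : Fin j, (d (Fin.last j).castSucc.castSucc / d (Fin.castLE hle i)) *
            (d (Fin.last (j + 1)).castSucc / d (Fin.castLE hle i))) *
          (d (Fin.last (j + 2)) / d (Sum.elim id id x)) ^ j)) (Finset.mem_univ (Sum.inl 0 : Fin (j + 3) ⊕ Fin (j + 3))))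

variable {ι : Type*} [Fintype ι] [DecidableEq ι] {E : Type*} [NormedAddCommGroup E] [NormedSpace ℂ E]
  (Φ : (ι → ℝ) ≃L[ℝ] E) {j : ℕ} {η : E [⋀^Fin 2]→L[ℝ] ℝ}

/-! ## §1 Degree one: `γ_{g−1} ∧ H¹(X, ℤ) + p·H^{2g−1}(X, ℤ) = H^{2g−1}(X, ℤ)` iff `p ∤ d_g/d₁` -/

/-- **Hard Lefschetz modulo `p` in degree one with the minimal class.** For a Riemann form of type `(d₁, …, d_g)` with a symplectic
enumeration (`g = j + 2`), the minimal curve class `γ_{g−1}` (`θ^{∧(g−1)} = ((g−1)!·d₁⋯d_{g−1})·γ_{g−1}`) and a prime `p`: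
**`γ_{g−1} ∧ H¹(X, ℤ) + p·H^{2g−1}(X, ℤ) = H^{2g−1}(X, ℤ)` — i.e. `γ_{g−1} ∪ (−) : H¹(X, ℤ/p) → H^{2g−1}(X, ℤ/p)` is onto, equivalently an
isomorphism — iff `p ∤ d_g/d₁`** (the index is `(∏_a d_g/d_a)²`, g40-#5, and `d_g/d_a ∣ d_g/d₁`). For a principal polarisation it holds for
every `p` (Poincaré's formula over `ℤ`). [cite: Lange2023AbelianVarietiesComplex, §5.4.1 Thm. 5.4.1 and (5.22) (PDF p. 275); §4.2 (PDF p. 204); §2.5.3 Cor. 2.5.17 (c) (PDF p. 135); §1.5.1 (PDF p. 51)] [cite: VoisinHodgeI2002, §6.2.3 Thm. 6.25 (PDF p. 125); §7.1.2 (PDF p. 134 L31)] [cite: BenoistDebarre2023SmoothSubvarietiesJacobians, §1 (p. 3)] -/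
theorem IsSymplecticEnum.map_wedge_integralForms_one_sup_map_nsmul_eq_iff_of_eq_content_smul {e₀ : Fin (j + 2) ⊕ Fin (j + 2) ≃ ι}
    {d : Fin (j + 2) → ℕ} (h : IsSymplecticEnum Φ e₀ η d) (hη : IsRiemannForm Φ η) (hle₁ : j + 1 ≤ j + 2)
    {m : E [⋀^Fin (2 * (j + 1))]→L[ℝ] ℂ}
    (hm : wedgePow (ofRealForm η) (j + 1) = (((j + 1).factorial * ∏ i : Fin (j + 1), d (Fin.castLE hle₁ i) : ℕ) : ℂ) • m)
    {p : ℕ} (hp : p.Prime) :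
    (integralForms Φ 1).map (AddMonoidHom.mk'
        (fun x : E [⋀^Fin 1]→L[ℝ] ℂ ↦ (m.wedge x : E [⋀^Fin (2 * j + 3)]→L[ℝ] ℂ))
        (ContinuousAlternatingMap.wedge_add_right _)) ⊔ (integralForms Φ (2 * j + 3)).map (nsmulAddMonoidHom p) =
      integralForms Φ (2 * j + 3) ↔ ¬ p ∣ d (Fin.last (j + 1)) / d 0 := by
  have hidx := h.relIndex_map_wedge_integralForms_one_eq_sq_of_eq_content_smul Φ hη hle₁ hm
  have hmZ : m ∈ integralForms Φ (2 * (j + 1)) := h.mem_integralForms_of_wedgePow_eq_content_smul Φ hη hle₁ hm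
  have hMH : (integralForms Φ 1).map (AddMonoidHom.mk'
      (fun x : E [⋀^Fin 1]→L[ℝ] ℂ ↦ (m.wedge x : E [⋀^Fin (2 * j + 3)]→L[ℝ] ℂ))
      (ContinuousAlternatingMap.wedge_add_right _)) ≤ integralForms Φ (2 * j + 3) := by
    rintro _ ⟨x, hx, rfl⟩
    exact wedge_mem_integralForms Φ hmZ hx
  have hfin : ((integralForms Φ 1).map (AddMonoidHom.mk'
      (fun x : E [⋀^Fin 1]→L[ℝ] ℂ ↦ (m.wedge x : E [⋀^Fin (2 * j + 3)]→L[ℝ] ℂ))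
      (ContinuousAlternatingMap.wedge_add_right _))).relIndex (integralForms Φ (2 * j + 3)) ≠ 0 := by
    rw [hidx]
    exact pow_ne_zero _ (Finset.prod_pos fun a _ ↦
      Nat.div_pos (Nat.le_of_dvd (h.pos hη _) (h.dvd _ _ (Fin.le_last a))) (h.pos hη a)).ne'
  rw [sup_map_nsmul_eq_iff_not_dvd_relIndex₄₂ hMH hfin hp, hidx, dvd_index_one_iff₄₂ h.dvd (h.pos hη) hp]

/-! ## §2 Degree two (`g ≥ 3`): `γ_{g−2} ∧ H²(X, ℤ) + p·H^{2g−2}(X, ℤ) = H^{2g−2}(X, ℤ)` iff `p ∤ (g−1)·d_g/d₁` -/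

/-- **Hard Lefschetz modulo `p` in degree two with the minimal class** (`g = j + 2 ≥ 3`): with `γ_{g−2}`, `θ^{∧(g−2)} = ((g−2)!·d₁⋯d_{g−2})·γ_{g−2}`,
and a prime `p`, **`γ_{g−2} ∧ H²(X, ℤ) + p·H^{2g−2}(X, ℤ) = H^{2g−2}(X, ℤ)` — `γ_{g−2} ∪ (−) : H²(X, ℤ/p) ⥲ H^{2g−2}(X, ℤ/p)` — iff
`p ∤ g − 1` and `p ∤ d_g/d₁`** (the index is `(g−1)·∏_i ((d_{g−1}/d_i)(d_g/d_i))^{2g−1}`, g40-#6). For a principal polarisation of dimension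
`g ≥ 3`: `θ^{g−2}/(g−2)!` induces an isomorphism `H²(X, ℤ/p) ⥲ H^{2g−2}(X, ℤ/p)` iff `p ∤ g − 1` (never for all `p` at once).
[cite: Lange2023AbelianVarietiesComplex, §5.4.1 Thm. 5.4.1 and (5.22) (PDF p. 275); §2.5.3 Thm. 2.5.16 and Cor. 2.5.17 (PDF p. 135); §1.5.1 (PDF p. 51)] [cite: VoisinHodgeI2002, §6.2.3 Thm. 6.25 (PDF p. 125); §7.1.2 (PDF p. 134 L31)] [cite: BenoistDebarre2023SmoothSubvarietiesJacobians, §1 (p. 3)] -/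
theorem IsSymplecticEnum.map_wedge_integralForms_two_sup_map_nsmul_eq_iff_of_eq_content_smul {e₀ : Fin (j + 2) ⊕ Fin (j + 2) ≃ ι}
    {d : Fin (j + 2) → ℕ} (h : IsSymplecticEnum Φ e₀ η d) (hη : IsRiemannForm Φ η) (hj : 1 ≤ j) (hle : j ≤ j + 2)
    {γ : E [⋀^Fin (2 * j)]→L[ℝ] ℂ} (hγ : wedgePow (ofRealForm η) j = ((j.factorial * ∏ i : Fin j, d (Fin.castLE hle i) : ℕ) : ℂ) • γ)
    {p : ℕ} (hp : p.Prime) :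
    (integralForms Φ 2).map (AddMonoidHom.mk' (fun x : E [⋀^Fin 2]→L[ℝ] ℂ ↦ γ.wedge x)
        (ContinuousAlternatingMap.wedge_add_right _)) ⊔ (integralForms Φ (2 * j + 2)).map (nsmulAddMonoidHom p) =
      integralForms Φ (2 * j + 2) ↔ ¬ p ∣ j + 1 ∧ ¬ p ∣ d (Fin.last (j + 1)) / d 0 := by
  have hidx := h.relIndex_map_wedge_integralForms_two_of_eq_content_smul Φ hη hle hγ
  have hMH := h.map_wedge_integralForms_two_le_of_eq_content_smul Φ hη hle hγ
  have hia : ∀ i : Fin j, Fin.castLE hle i ≤ (Fin.last j).castSucc := fun i ↦ Fin.le_def.2 (show (i : ℕ) ≤ j from i.2.le)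
  have hfin : ((integralForms Φ 2).map (AddMonoidHom.mk' (fun x : E [⋀^Fin 2]→L[ℝ] ℂ ↦ γ.wedge x)
      (ContinuousAlternatingMap.wedge_add_right _))).relIndex (integralForms Φ (2 * j + 2)) ≠ 0 := by
    rw [hidx]
    refine Nat.mul_ne_zero (Nat.succ_ne_zero j) (pow_ne_zero _ (Finset.prod_pos fun i _ ↦ Nat.mul_pos ?_ ?_).ne')
    · exact Nat.div_pos (Nat.le_of_dvd (h.pos hη _) (h.dvd _ _ (hia i))) (h.pos hη _)
    · exact Nat.div_pos (Nat.le_of_dvd (h.pos hη _) (h.dvd _ _ (Fin.le_last _))) (h.pos hη _)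
  rw [sup_map_nsmul_eq_iff_not_dvd_relIndex₄₂ hMH hfin hp, hidx, dvd_index_two_iff₄₂ h.dvd (h.pos hη) hj hle hp, not_or]

/-! ## §3 Degree three (`g ≥ 4`): `γ_{g−3} ∧ H³(X, ℤ) + p·H^{2g−3}(X, ℤ) = H^{2g−3}(X, ℤ)` iff `p ∤ (g−2)·d_g/d₁` -/

/-- **Hard Lefschetz modulo `p` in degree three with the minimal class** (`g = j + 3 ≥ 4`): with `γ_{g−3}`, `θ^{∧(g−3)} = ((g−3)!·d₁⋯d_{g−3})·γ_{g−3}`,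
and a prime `p`, **`γ_{g−3} ∧ H³(X, ℤ) + p·H^{2g−3}(X, ℤ) = H^{2g−3}(X, ℤ)` — `γ_{g−3} ∪ (−) : H³(X, ℤ/p) ⥲ H^{2g−3}(X, ℤ/p)` — iff
`p ∤ g − 2` and `p ∤ d_g/d₁`** (the index of g40-#7: its prime divisors are those of `g − 2` and of the ratios `d_m/d_i ∣ d_g/d₁`). For a principal
polarisation of dimension `g ≥ 4`: `θ^{g−3}/(g−3)!` induces `H³(X, ℤ/p) ⥲ H^{2g−3}(X, ℤ/p)` iff `p ∤ g − 2`.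
[cite: Lange2023AbelianVarietiesComplex, §5.4.1 Thm. 5.4.1 and (5.22) (PDF p. 275); §2.5.3 Thm. 2.5.16 and Cor. 2.5.17 (PDF p. 135); §1.5.1 (PDF p. 51); §1.1.3 Exercise 1.1.6 (8)] [cite: VoisinHodgeI2002, §6.2.3 Thm. 6.25 (PDF p. 125); §7.1.2 (PDF p. 134 L31)] [cite: BenoistDebarre2023SmoothSubvarietiesJacobians, §1 (p. 3)] -/
theorem IsSymplecticEnum.map_wedge_integralForms_three_hardLefschetz_sup_map_nsmul_eq_iff_of_eq_content_smul
    {e₀ : Fin (j + 3) ⊕ Fin (j + 3) ≃ ι} {d : Fin (j + 3) → ℕ} (h : IsSymplecticEnum Φ e₀ η d) (hη : IsRiemannForm Φ η) (hj : 1 ≤ j)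
    (hle : j ≤ j + 3) {γ : E [⋀^Fin (2 * j)]→L[ℝ] ℂ}
    (hγ : wedgePow (ofRealForm η) j = ((j.factorial * ∏ i : Fin j, d (Fin.castLE hle i) : ℕ) : ℂ) • γ) {p : ℕ} (hp : p.Prime) :
    (integralForms Φ 3).map (AddMonoidHom.mk' (fun x : E [⋀^Fin 3]→L[ℝ] ℂ ↦ γ.wedge x)
        (ContinuousAlternatingMap.wedge_add_right _)) ⊔ (integralForms Φ (2 * j + 3)).map (nsmulAddMonoidHom p) =
      integralForms Φ (2 * j + 3) ↔ ¬ p ∣ j + 1 ∧ ¬ p ∣ d (Fin.last (j + 2)) / d 0 := by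
  have hidx := h.relIndex_map_wedge_integralForms_three_hardLefschetz_of_eq_content_smul Φ hη hle hγ
  have hMH := h.map_wedge_integralForms_three_hardLefschetz_le_of_eq_content_smul Φ hη hle hγ
  have hia : ∀ i : Fin j, Fin.castLE hle i ≤ (Fin.last j).castSucc.castSucc := fun i ↦ Fin.le_def.2 (show (i : ℕ) ≤ j from i.2.le)
  have hib : ∀ i : Fin j, Fin.castLE hle i ≤ (Fin.last (j + 1)).castSucc := fun i ↦ Fin.le_def.2 (show (i : ℕ) ≤ j + 1 by omega)
  have hcard : ∀ u : {u : Fin 3 → Fin (j + 3) ⊕ Fin (j + 3) //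
      Sum.elim id id (u 0) < Sum.elim id id (u 1) ∧ Sum.elim id id (u 1) < Sum.elim id id (u 2)},
      ((Finset.univ.image fun m ↦ Sum.elim id id (u.1 m))ᶜ).card = j := fun u ↦ by
    have hsm : StrictMono fun m ↦ Sum.elim id id (u.1 m) := by
      refine Fin.strictMono_iff_lt_succ.2 fun i ↦ ?_
      fin_cases i
      · exact u.2.1
      · exact u.2.2
    rw [Finset.card_compl, Finset.card_image_of_injective _ hsm.injective, Finset.card_univ, Fintype.card_fin, Fintype.card_fin]
    omega
  have hfin : ((integralForms Φ 3).map (AddMonoidHom.mk' (fun x : E [⋀^Fin 3]→L[ℝ] ℂ ↦ γ.wedge x)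
      (ContinuousAlternatingMap.wedge_add_right _))).relIndex (integralForms Φ (2 * j + 3)) ≠ 0 := by
    rw [hidx]
    refine Nat.mul_ne_zero (Finset.prod_pos fun u _ ↦ ?_).ne' (Finset.prod_pos fun x _ ↦ Nat.mul_pos (Nat.succ_pos j)
      (Nat.mul_pos (Finset.prod_pos fun i _ ↦ Nat.mul_pos ?_ ?_) (pow_pos ?_ _))).ne'
    · refine Nat.div_pos (Nat.le_of_dvd (Finset.prod_pos fun ν _ ↦ h.pos hη ν) ?_) (Finset.prod_pos fun i _ ↦ h.pos hη _)
      exact prod_castLE_dvd_prod_of_card_eq h.dvd hle (hcard u)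
    · exact Nat.div_pos (Nat.le_of_dvd (h.pos hη _) (h.dvd _ _ (hia i))) (h.pos hη _)
    · exact Nat.div_pos (Nat.le_of_dvd (h.pos hη _) (h.dvd _ _ (hib i))) (h.pos hη _)
    · exact Nat.div_pos (Nat.le_of_dvd (h.pos hη _) (h.dvd _ _ (Fin.le_last _))) (h.pos hη _)
  rw [sup_map_nsmul_eq_iff_not_dvd_relIndex₄₂ hMH hfin hp, hidx, dvd_index_three_iff₄₂ h.dvd (h.pos hη) hj hle hp, not_or]

/-! ## §4 Basis-free forms: any presentation of a polarised torus of type `(d₁, …, d_g)` -/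

/-- **Degree one, any presentation**: `γ_{g−1} ∧ H¹(X, ℤ) + p·H^{2g−1}(X, ℤ) = H^{2g−1}(X, ℤ)` iff `p ∤ d_g/d₁` (`g = j + 2`).
[cite: Lange2023AbelianVarietiesComplex, §1.5.1 (PDF p. 51), §4.2 (PDF p. 204), §5.4.1 (5.22) (PDF p. 275)] [cite: VoisinHodgeI2002, §7.1.2 (PDF p. 134 L31)] -/
theorem IsPolarizationType.map_wedge_integralForms_one_sup_map_nsmul_eq_iff_of_eq_content_smul {Φ : (ι → ℝ) ≃L[ℝ] E}
    {d : Fin (j + 2) → ℕ} (hd : IsPolarizationType Φ η d) (hη : IsRiemannForm Φ η) (hle₁ : j + 1 ≤ j + 2)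
    {m : E [⋀^Fin (2 * (j + 1))]→L[ℝ] ℂ}
    (hm : wedgePow (ofRealForm η) (j + 1) = (((j + 1).factorial * ∏ i : Fin (j + 1), d (Fin.castLE hle₁ i) : ℕ) : ℂ) • m)
    {p : ℕ} (hp : p.Prime) :
    (integralForms Φ 1).map (AddMonoidHom.mk'
        (fun x : E [⋀^Fin 1]→L[ℝ] ℂ ↦ (m.wedge x : E [⋀^Fin (2 * j + 3)]→L[ℝ] ℂ))
        (ContinuousAlternatingMap.wedge_add_right _)) ⊔ (integralForms Φ (2 * j + 3)).map (nsmulAddMonoidHom p) =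
      integralForms Φ (2 * j + 3) ↔ ¬ p ∣ d (Fin.last (j + 1)) / d 0 := by
  obtain ⟨Φ', hΛ, hs⟩ := hd.exists_isSymplecticEnum Φ
  rw [integralForms_eq_of_range_latticeVec_eq hΛ.symm 1, integralForms_eq_of_range_latticeVec_eq hΛ.symm (2 * j + 3)]
  exact hs.map_wedge_integralForms_one_sup_map_nsmul_eq_iff_of_eq_content_smul Φ' (hη.of_range_latticeVec_subset hΛ.le) hle₁ hm hp

/-- **Degree two, any presentation** (`g = j + 2 ≥ 3`): `γ_{g−2} ∧ H²(X, ℤ) + p·H^{2g−2}(X, ℤ) = H^{2g−2}(X, ℤ)` iff `p ∤ g − 1` and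
`p ∤ d_g/d₁`. [cite: Lange2023AbelianVarietiesComplex, §1.5.1 (PDF p. 51), §5.4.1 Thm. 5.4.1 and (5.22) (PDF p. 275)] [cite: VoisinHodgeI2002, §7.1.2 (PDF p. 134 L31)] -/
theorem IsPolarizationType.map_wedge_integralForms_two_sup_map_nsmul_eq_iff_of_eq_content_smul {Φ : (ι → ℝ) ≃L[ℝ] E}
    {d : Fin (j + 2) → ℕ} (hd : IsPolarizationType Φ η d) (hη : IsRiemannForm Φ η) (hj : 1 ≤ j) (hle : j ≤ j + 2)
    {γ : E [⋀^Fin (2 * j)]→L[ℝ] ℂ} (hγ : wedgePow (ofRealForm η) j = ((j.factorial * ∏ i : Fin j, d (Fin.castLE hle i) : ℕ) : ℂ) • γ)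
    {p : ℕ} (hp : p.Prime) :
    (integralForms Φ 2).map (AddMonoidHom.mk' (fun x : E [⋀^Fin 2]→L[ℝ] ℂ ↦ γ.wedge x)
        (ContinuousAlternatingMap.wedge_add_right _)) ⊔ (integralForms Φ (2 * j + 2)).map (nsmulAddMonoidHom p) =
      integralForms Φ (2 * j + 2) ↔ ¬ p ∣ j + 1 ∧ ¬ p ∣ d (Fin.last (j + 1)) / d 0 := by
  obtain ⟨Φ', hΛ, hs⟩ := hd.exists_isSymplecticEnum Φ
  rw [integralForms_eq_of_range_latticeVec_eq hΛ.symm 2, integralForms_eq_of_range_latticeVec_eq hΛ.symm (2 * j + 2)]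
  exact hs.map_wedge_integralForms_two_sup_map_nsmul_eq_iff_of_eq_content_smul Φ' (hη.of_range_latticeVec_subset hΛ.le) hj hle hγ hp

/-- **Degree three, any presentation** (`g = j + 3 ≥ 4`): `γ_{g−3} ∧ H³(X, ℤ) + p·H^{2g−3}(X, ℤ) = H^{2g−3}(X, ℤ)` iff `p ∤ g − 2` and
`p ∤ d_g/d₁`. [cite: Lange2023AbelianVarietiesComplex, §1.5.1 (PDF p. 51), §5.4.1 Thm. 5.4.1 and (5.22) (PDF p. 275)] [cite: VoisinHodgeI2002, §7.1.2 (PDF p. 134 L31)] -/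
theorem IsPolarizationType.map_wedge_integralForms_three_hardLefschetz_sup_map_nsmul_eq_iff_of_eq_content_smul {Φ : (ι → ℝ) ≃L[ℝ] E}
    {d : Fin (j + 3) → ℕ} (hd : IsPolarizationType Φ η d) (hη : IsRiemannForm Φ η) (hj : 1 ≤ j) (hle : j ≤ j + 3)
    {γ : E [⋀^Fin (2 * j)]→L[ℝ] ℂ} (hγ : wedgePow (ofRealForm η) j = ((j.factorial * ∏ i : Fin j, d (Fin.castLE hle i) : ℕ) : ℂ) • γ)
    {p : ℕ} (hp : p.Prime) :
    (integralForms Φ 3).map (AddMonoidHom.mk' (fun x : E [⋀^Fin 3]→L[ℝ] ℂ ↦ γ.wedge x)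
        (ContinuousAlternatingMap.wedge_add_right _)) ⊔ (integralForms Φ (2 * j + 3)).map (nsmulAddMonoidHom p) =
      integralForms Φ (2 * j + 3) ↔ ¬ p ∣ j + 1 ∧ ¬ p ∣ d (Fin.last (j + 2)) / d 0 := by
  obtain ⟨Φ', hΛ, hs⟩ := hd.exists_isSymplecticEnum Φ
  rw [integralForms_eq_of_range_latticeVec_eq hΛ.symm 3, integralForms_eq_of_range_latticeVec_eq hΛ.symm (2 * j + 3)]
  exact hs.map_wedge_integralForms_three_hardLefschetz_sup_map_nsmul_eq_iff_of_eq_content_smul Φ'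
    (hη.of_range_latticeVec_subset hΛ.le) hj hle hγ hp

end HardLefschetzModPrime

end Literature.Geometry.Kaehler.ComplexTorus
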